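import Summits.QuantumFields.YangMills.Theorems.LuscherReductionTwistedTraceScalingMehlerGap
import HarnessLib

/-!
# (B-ST) step (D3)-flat: the MEHLER GAP AS A POINCARÉ INEQUALITY in the ground-state representation —
# `λ₀(1−ρ)·Var_{h₀²}(g) ≤ ½∫∫ (g(x) − g(y))²·h₀(x)K(x,y)h₀(y)`
# (lane A of S-BASE, crux `TwistedTraceScaling` stmt-QuantumFields-20203, C4-CORE, the (B-ST) pen; design card `pub/ym-fleet/ym-luscher-20007-p1/Lines-BST-poincare.md` (D3))

The door `…BOStiffDoor.form_le_of_quasimode_of_comparison` consumes a FLAT Poincaré inequality for a reference pair (weight `D`, jump kernel `J₀`).  For the stiff directions the flat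
model is the harmonic (Mehler) transfer kernel `K = mehlerKernel a b` (`a_k² + 2a_kb_k = π²`), whose ground state is the Gaussian `h₀ = hR 0` with `K h₀ = λ₀ h₀`,
`λ₀ = Π√(π/(a_k+b_k+π))`, and whose gap is `…MehlerGap.mehlerForm_le_gap`: `Q(f,f) ≤ λ₀[(1−ρ)c₀(f)² + ρ‖f‖²]` for `ρ ∈ [max_k r_k, 1]`.  In the ground-state representation
`f = g·h₀` this IS a Poincaré inequality for the probability measure `h₀² dx` and the jump kernel `h₀(x)K(x,y)h₀(y)`:
* §1 ★ `groundState_identity_of_integrable` — the ground-state identity `∫∫ (gΘ)M(gΘ) = ∫ g²Θ·(MΘ) − ½∫∫(g(x)−g(y))²ΘMΘ` on an arbitrary s-finite measure space under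
  integrability hypotheses (the finite-measure/bounded version is `…BOStiffDoor.groundState_identity`; the flat model lives on Lebesgue measure);
* §2 ★★★ `mehler_poincare` — for bounded measurable `g`: `λ₀·(1−ρ)·(∫ g²h₀² − (∫ g h₀²)²) ≤ ½∫∫ (g(x)−g(y))² h₀(x)K(x,y)h₀(y) dx dy`;
  ★★ `mehler_poincare_normal` — the door's shape `∫ g²D − (∫ gD)²/∫D ≤ P₀·½∫∫(g−g')²J₀` with `D = h₀²` (`∫ D = 1`), `J₀ = h₀Kh₀/λ₀`, `P₀ = 1/(1−ρ)` (`ρ < 1`), i.e. `1/P₀ = θ_S`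
  after `…MehlerScaling.mehler_normalisation` (`ρ = mehlerRatio g₀(L)`).
The tensorisation with the gauge zero modes (independent Gaussian resampling, matched profile κ = 1) and the smeared slow ball (rank one up to `1 ± o(1)`) is the next file.
HONEST FRAMING: classical `L²` bookkeeping (Mehler 1866 in Dirichlet-form language) for a stub of a child of the CONDITIONAL route R2b1; (B-ST) OPEN; not infinite volume, not a gap, not Clay.

## References
* A. Wipf, *Statistical Approach to Quantum Field Theory*, LNP 992, Springer 2021, §8.5.1 (8.58). [Wipf2021]
* G. B. Folland, *Harmonic Analysis in Phase Space*, Princeton UP 1989, §1.7 (vii). [Folland1989]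
-/

set_option autoImplicit false

noncomputable section

open MvPolynomial Complex MeasureTheory Filter Topology
open scoped Real

namespace Summit.QuantumFields.YangMills.Theorems.FemtoTransferGap.Mehler

open Literature.Analysis.SegalBargmann

/-! ## §1 The ground-state identity under integrability hypotheses -/

section Identity

variable {X : Type*} [MeasurableSpace X] {μ : Measure X} [SFinite μ] {M : X → X → ℝ} {Θ g : X → ℝ}

/-- ★ **Ground-state identity (s-finite measure, integrable data).**  If `M` is symmetric and the integrands `(gΘ)(x)M(x,y)(gΘ)(y)` and `g(x)²Θ(x)M(x,y)Θ(y)` are integrable on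
`μ ⊗ μ`, then `∫∫ (gΘ)(x)M(x,y)(gΘ)(y) = ∫ g(x)²Θ(x)(∫ M(x,y)Θ(y)dy)dx − ½∫∫ (g(x)−g(y))²Θ(x)M(x,y)Θ(y)`. [cite: Helffer2013, §7] -/
theorem groundState_identity_of_integrable (hsymm : ∀ x y, M x y = M y x)
    (i1 : Integrable (fun p : X × X => g p.1 * Θ p.1 * M p.1 p.2 * (g p.2 * Θ p.2)) (μ.prod μ))
    (i2 : Integrable (fun p : X × X => g p.1 ^ 2 * Θ p.1 * M p.1 p.2 * Θ p.2) (μ.prod μ)) :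
    ∫ x, ∫ y, (g x * Θ x) * M x y * (g y * Θ y) ∂μ ∂μ =
      (∫ x, g x ^ 2 * Θ x * (∫ y, M x y * Θ y ∂μ) ∂μ) - (1 / 2) * ∫ x, ∫ y, (g x - g y) ^ 2 * (Θ x * M x y * Θ y) ∂μ ∂μ := by
  -- the swapped middle integrand
  have i3 : Integrable (fun p : X × X => g p.2 ^ 2 * Θ p.1 * M p.1 p.2 * Θ p.2) (μ.prod μ) := by
    refine i2.swap.congr (ae_of_all _ fun p => ?_)
    simp only [Function.comp_apply, Prod.fst_swap, Prod.snd_swap]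
    rw [hsymm p.2 p.1]; ring
  have i4 : Integrable (fun p : X × X => (g p.1 - g p.2) ^ 2 * (Θ p.1 * M p.1 p.2 * Θ p.2)) (μ.prod μ) := by
    have i23 : Integrable (fun p : X × X => g p.1 ^ 2 * Θ p.1 * M p.1 p.2 * Θ p.2 + g p.2 ^ 2 * Θ p.1 * M p.1 p.2 * Θ p.2) (μ.prod μ) := i2.add i3
    have i1' : Integrable (fun p : X × X => 2 * (g p.1 * Θ p.1 * M p.1 p.2 * (g p.2 * Θ p.2))) (μ.prod μ) := i1.const_mul 2
    exact (i23.sub i1').congr (ae_of_all _ fun p => by simp only [Pi.sub_apply]; ring)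
  -- iterated integrals as product integrals
  have e1 : ∫ x, ∫ y, (g x * Θ x) * M x y * (g y * Θ y) ∂μ ∂μ = ∫ p, g p.1 * Θ p.1 * M p.1 p.2 * (g p.2 * Θ p.2) ∂(μ.prod μ) := (integral_prod _ i1).symm
  have e2 : (∫ x, g x ^ 2 * Θ x * (∫ y, M x y * Θ y ∂μ) ∂μ) = ∫ p, g p.1 ^ 2 * Θ p.1 * M p.1 p.2 * Θ p.2 ∂(μ.prod μ) := by
    rw [integral_prod _ i2]
    refine integral_congr_ae (ae_of_all _ fun x => ?_)
    dsimp only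
    rw [← integral_const_mul]
    refine integral_congr_ae (ae_of_all _ fun y => ?_); dsimp only; ring
  have e4 : ∫ x, ∫ y, (g x - g y) ^ 2 * (Θ x * M x y * Θ y) ∂μ ∂μ = ∫ p, (g p.1 - g p.2) ^ 2 * (Θ p.1 * M p.1 p.2 * Θ p.2) ∂(μ.prod μ) := (integral_prod _ i4).symm
  -- the swapped term equals the middle term
  have eswap : ∫ p, g p.2 ^ 2 * Θ p.1 * M p.1 p.2 * Θ p.2 ∂(μ.prod μ) = ∫ p, g p.1 ^ 2 * Θ p.1 * M p.1 p.2 * Θ p.2 ∂(μ.prod μ) := by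
    rw [← integral_prod_swap (μ := μ) (ν := μ) (fun p : X × X => g p.1 ^ 2 * Θ p.1 * M p.1 p.2 * Θ p.2)]
    refine integral_congr_ae (ae_of_all _ fun p => ?_)
    simp only [Prod.swap]
    rw [hsymm p.2 p.1]; ring
  -- expand
  have eexp : ∫ p, (g p.1 - g p.2) ^ 2 * (Θ p.1 * M p.1 p.2 * Θ p.2) ∂(μ.prod μ) =
      (∫ p, g p.1 ^ 2 * Θ p.1 * M p.1 p.2 * Θ p.2 ∂(μ.prod μ)) + (∫ p, g p.2 ^ 2 * Θ p.1 * M p.1 p.2 * Θ p.2 ∂(μ.prod μ)) -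
        2 * ∫ p, g p.1 * Θ p.1 * M p.1 p.2 * (g p.2 * Θ p.2) ∂(μ.prod μ) := by
    have i23 : Integrable (fun p : X × X => g p.1 ^ 2 * Θ p.1 * M p.1 p.2 * Θ p.2 + g p.2 ^ 2 * Θ p.1 * M p.1 p.2 * Θ p.2) (μ.prod μ) := i2.add i3
    have i1' : Integrable (fun p : X × X => 2 * (g p.1 * Θ p.1 * M p.1 p.2 * (g p.2 * Θ p.2))) (μ.prod μ) := i1.const_mul 2
    have h1 : ∫ p, (g p.1 - g p.2) ^ 2 * (Θ p.1 * M p.1 p.2 * Θ p.2) ∂(μ.prod μ) =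
        ∫ p, ((g p.1 ^ 2 * Θ p.1 * M p.1 p.2 * Θ p.2 + g p.2 ^ 2 * Θ p.1 * M p.1 p.2 * Θ p.2) - 2 * (g p.1 * Θ p.1 * M p.1 p.2 * (g p.2 * Θ p.2))) ∂(μ.prod μ) :=
      integral_congr_ae (ae_of_all _ fun p => by ring)
    rw [h1, integral_sub i23 i1', integral_add i2 i3, integral_const_mul]
  rw [e1, e2, e4, eexp, eswap]
  ring

end Identity

/-! ## §2 ★★★ The Mehler gap in Poincaré form -/

section Poincare

variable {σ : Type*} [Fintype σ] [DecidableEq σ]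

/-- The eigen-equation of the ground state: `∫ K(x,y) hR 0 (y) dy = λ₀ · hR 0 (x)`. [cite: Wipf2021, §8.5.1 (8.56)] -/
theorem integral_mehlerKernel_mul_hR_zero {a b : σ → ℝ} (hs : ∀ k, 0 < a k + b k + π) (hab : ∀ k, a k ^ 2 + 2 * a k * b k = π ^ 2) (x : σ → ℝ) :
    ∫ y, mehlerKernel a b x y * hR 0 y = (∏ k, Real.sqrt (π / (a k + b k + π))) * hR 0 x := by
  rw [integral_mehlerKernel_mul_hR hs hab 0 x]
  simp

/-- `∫ (hR 0)² = 1`. [cite: Folland1989, §1.7 (vii)] -/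
theorem integral_hR_zero_sq : ∫ x : σ → ℝ, hR 0 x ^ 2 = 1 := by
  have h := integral_hR_mul_hR (σ := σ) 0 0
  simp only [if_true] at h
  rw [← h]
  exact integral_congr_ae (ae_of_all _ fun x => by ring)

omit [DecidableEq σ] in
/-- A bounded measurable multiple of an `L²` function is in `L²`. [folklore] -/
theorem memLp_bdd_mul {g u : (σ → ℝ) → ℝ} (hg : Measurable g) {Cg : ℝ} (hgb : ∀ x, |g x| ≤ Cg) (hu : MemLp u 2 (volume : Measure (σ → ℝ))) :
    MemLp (fun x => g x * u x) 2 (volume : Measure (σ → ℝ)) := by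
  refine hu.of_le_mul (c := Cg) (hg.aestronglyMeasurable.mul hu.aestronglyMeasurable) (ae_of_all _ fun x => ?_)
  rw [Real.norm_eq_abs, Real.norm_eq_abs, abs_mul]
  exact mul_le_mul_of_nonneg_right (hgb x) (abs_nonneg _)

/-- ★★★ **THE MEHLER GAP AS A POINCARÉ INEQUALITY.**  `0 < a_k`, `0 < b_k`, `a_k² + 2a_kb_k = π²`, `r_k = b_k/(a_k+b_k+π) ≤ ρ ≤ 1`, `0 ≤ ρ`; `h₀ = hR 0`, `λ₀ = Π√(π/(a_k+b_k+π))`.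
For every bounded measurable `g`:  `λ₀·(1 − ρ)·(∫ g²h₀² − (∫ g·h₀²)²) ≤ ½ ∫∫ (g(x) − g(y))²·h₀(x)K(x,y)h₀(y) dx dy`. [cite: Wipf2021, §8.5.1 (8.58)] [cite: Folland1989, §1.7 (vii)] -/
theorem mehler_poincare {a b : σ → ℝ} (ha : ∀ k, 0 < a k) (hb : ∀ k, 0 < b k) (hab : ∀ k, a k ^ 2 + 2 * a k * b k = π ^ 2)
    {ρ : ℝ} (hρ0 : 0 ≤ ρ) (hρ : ∀ k, b k / (a k + b k + π) ≤ ρ) (hρ1 : ρ ≤ 1) {g : (σ → ℝ) → ℝ} (hg : Measurable g) {Cg : ℝ} (hgb : ∀ x, |g x| ≤ Cg) :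
    (∏ k, Real.sqrt (π / (a k + b k + π))) * (1 - ρ) * ((∫ x, g x ^ 2 * hR 0 x ^ 2) - (∫ x, g x * hR 0 x ^ 2) ^ 2) ≤
      (1 / 2) * ∫ x, ∫ y, (g x - g y) ^ 2 * (hR 0 x * mehlerKernel a b x y * hR 0 y) := by
  have hb' : ∀ k, 0 ≤ b k := fun k => (hb k).le
  have hs : ∀ k, 0 < a k + b k + π := fun k => by have := ha k; have := hb k; positivity
  set L0 : ℝ := ∏ k, Real.sqrt (π / (a k + b k + π)) with hL0
  have h0 : MemLp (hR (0 : σ →₀ ℕ)) 2 (volume : Measure (σ → ℝ)) := memLp_hR 0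
  -- `f = g·h₀ ∈ L²`, `g²h₀ ∈ L²`
  have hf : MemLp (fun x => g x * hR 0 x) 2 (volume : Measure (σ → ℝ)) := memLp_bdd_mul hg hgb h0
  have hsqb : ∀ x, |g x ^ 2| ≤ Cg ^ 2 := fun x => by rw [abs_pow]; exact pow_le_pow_left₀ (abs_nonneg _) (hgb x) 2
  have hf2 : MemLp (fun x => g x ^ 2 * hR 0 x) 2 (volume : Measure (σ → ℝ)) := memLp_bdd_mul (hg.pow_const 2) hsqb h0
  -- the two integrability hypotheses of the identity
  have i1 : Integrable (fun p : (σ → ℝ) × (σ → ℝ) => g p.1 * hR 0 p.1 * mehlerKernel a b p.1 p.2 * (g p.2 * hR 0 p.2)) ((volume : Measure (σ → ℝ)).prod volume) :=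
    integrable_mehlerForm_integrand ha hb' hf hf
  have i2 : Integrable (fun p : (σ → ℝ) × (σ → ℝ) => g p.1 ^ 2 * hR 0 p.1 * mehlerKernel a b p.1 p.2 * hR 0 p.2) ((volume : Measure (σ → ℝ)).prod volume) :=
    integrable_mehlerForm_integrand ha hb' hf2 h0
  have hid := groundState_identity_of_integrable (μ := (volume : Measure (σ → ℝ))) (mehlerKernel_comm a b) i1 i2
  -- the form of `f`, the gap, the eigen-equation
  have hQ : mehlerForm a b (fun x => g x * hR 0 x) (fun x => g x * hR 0 x) = ∫ x, ∫ y, (g x * hR 0 x) * mehlerKernel a b x y * (g y * hR 0 y) := rfl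
  have hgap := mehlerForm_le_gap ha hb hab hρ0 hρ hρ1 hf
  have hc0 : hermCoeff (fun x => g x * hR 0 x) 0 = ∫ x, g x * hR 0 x ^ 2 := by
    unfold hermCoeff
    exact integral_congr_ae (ae_of_all _ fun x => by ring)
  have hn : (∫ x, (fun x => g x * hR 0 x) x ^ 2) = ∫ x, g x ^ 2 * hR 0 x ^ 2 := integral_congr_ae (ae_of_all _ fun x => by ring)
  have hmid : (∫ x, g x ^ 2 * hR 0 x * (∫ y, mehlerKernel a b x y * hR 0 y)) = L0 * ∫ x, g x ^ 2 * hR 0 x ^ 2 := by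
    rw [← integral_const_mul]
    refine integral_congr_ae (ae_of_all _ fun x => ?_)
    dsimp only
    rw [integral_mehlerKernel_mul_hR_zero hs hab x]; ring
  rw [hQ, hid, hmid, hc0, hn] at hgap
  -- `½D = λ₀N − Q ≥ λ₀N − λ₀[(1−ρ)m² + ρN]`
  nlinarith [hgap]

/-- ★★ **Normal form for the door** (`ρ < 1`): with `D = (hR 0)²` (`∫ D = 1`), `J₀ = hR 0 · K · hR 0/λ₀` and `P₀ = 1/(1−ρ)`:
`∫ g²D − (∫ gD)²/∫D ≤ P₀·½∫∫(g(x)−g(y))²J₀(x,y)` for every bounded measurable `g`. [cite: Wipf2021, §8.5.1 (8.58)] -/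
theorem mehler_poincare_normal {a b : σ → ℝ} (ha : ∀ k, 0 < a k) (hb : ∀ k, 0 < b k) (hab : ∀ k, a k ^ 2 + 2 * a k * b k = π ^ 2)
    {ρ : ℝ} (hρ0 : 0 ≤ ρ) (hρ : ∀ k, b k / (a k + b k + π) ≤ ρ) (hρ1 : ρ < 1) {g : (σ → ℝ) → ℝ} (hg : Measurable g) {Cg : ℝ} (hgb : ∀ x, |g x| ≤ Cg) :
    (∫ x, g x ^ 2 * hR 0 x ^ 2) - (∫ x, g x * hR 0 x ^ 2) ^ 2 / (∫ x : σ → ℝ, hR 0 x ^ 2) ≤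
      (1 / (1 - ρ)) * ((1 / 2) * ∫ x, ∫ y, (g x - g y) ^ 2 * (hR 0 x * mehlerKernel a b x y * hR 0 y / ∏ k, Real.sqrt (π / (a k + b k + π)))) := by
  have hs : ∀ k, 0 < a k + b k + π := fun k => by have := ha k; have := hb k; positivity
  have hL0 : 0 < ∏ k, Real.sqrt (π / (a k + b k + π)) := Finset.prod_pos fun k _ => Real.sqrt_pos.2 (div_pos Real.pi_pos (hs k))
  have h := mehler_poincare ha hb hab hρ0 hρ hρ1.le hg hgb
  rw [integral_hR_zero_sq, div_one]
  have e : ∫ x, ∫ y, (g x - g y) ^ 2 * (hR 0 x * mehlerKernel a b x y * hR 0 y / ∏ k, Real.sqrt (π / (a k + b k + π))) =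
      (∫ x, ∫ y, (g x - g y) ^ 2 * (hR 0 x * mehlerKernel a b x y * hR 0 y)) / ∏ k, Real.sqrt (π / (a k + b k + π)) := by
    rw [eq_div_iff hL0.ne', ← integral_mul_const]
    refine integral_congr_ae (ae_of_all _ fun x => ?_)
    dsimp only
    rw [← integral_mul_const]
    refine integral_congr_ae (ae_of_all _ fun y => ?_)
    dsimp only
    field_simp
  rw [e]
  have h1ρ : 0 < 1 - ρ := by linarith
  rw [← sub_nonneg] at h ⊢
  have key : 1 / (1 - ρ) * (1 / 2 * ((∫ x, ∫ y, (g x - g y) ^ 2 * (hR 0 x * mehlerKernel a b x y * hR 0 y)) / ∏ k, Real.sqrt (π / (a k + b k + π)))) -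
      ((∫ x, g x ^ 2 * hR 0 x ^ 2) - (∫ x, g x * hR 0 x ^ 2) ^ 2) =
      ((1 / 2 * ∫ x, ∫ y, (g x - g y) ^ 2 * (hR 0 x * mehlerKernel a b x y * hR 0 y)) -
        (∏ k, Real.sqrt (π / (a k + b k + π))) * (1 - ρ) * ((∫ x, g x ^ 2 * hR 0 x ^ 2) - (∫ x, g x * hR 0 x ^ 2) ^ 2)) / ((1 - ρ) * ∏ k, Real.sqrt (π / (a k + b k + π))) := by
    field_simp
  rw [key]
  exact div_nonneg h (mul_pos h1ρ hL0).le

end Poincare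

end Summit.QuantumFields.YangMills.Theorems.FemtoTransferGap.Mehler

end
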